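import Summits.QuantumFields.YangMills.Theorems.BalabanUVNodesN12FlatHndConnLetter
import Summits.QuantumFields.YangMills.Theorems.UnitScaleTiltProp7TentInterpolation
import Literature.MathematicalPhysics.QuantumFieldTheory.Balaban1983to89.TorusGeometry
import Literature.MathematicalPhysics.QuantumFieldTheory.Balaban1983to89.B6QGQTestBumpsKLevelV1
import HarnessLib

/-!
# BalabanUVNodes ∕ N12 — (β)♭: THE HARMONIC LETTER (L♭) FOR THE RECORD's `𝐁_k(Z)`, EVERY `Z` — the loop letter (L) of `N12FlatFibreNullSpaceDetSet` is replaced by what it was used for («a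
# constrained affine potential `φ(c₊) − φ(c₋) + L^j·A = 0` has `A = 0`»), and (L♭) is PROVED for `Bj M₁ Z k` with NO hypothesis on `Z`: the flat real `hnondeg` letter on the
# `𝐁_k(Z)`-adapted hierarchical axial slice now carries no geometric letter and no line-miss hypothesis

Cell `pub-ymgap` (HUMAN RULINGS D-0062 ∕ D-0149), WIDTH SEAT `pub-ymgap-dag-n12-w3` g2 (node N12 = [B15]; key K1⁷ `stmt-QuantumFields-20542`, `--supports … --as helper`; count-neutral).  THEOREMS ONLY.
WHY.  `N12FlatHndConnLetter.hnondeg_real_flat_hierAxial_Bj` still displayed `hline` («one lattice line per direction misses `Z`»), the sufficient condition for the loop letter (L); a large-field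
region `Z` wrapping around the torus violates it (and (L) — a full `μ`-loop of constrained bonds at ONE level — may then fail).  But (L) only served to kill the constant vector part `A` of a
curl-free constrained field `X = dφ + A` (`N12FlatFibreNullSpace.exists_grad_add_dirConst_of_plaq_eq_zero_matrix`), and THAT holds for every `Z`: with the label potential `Λ(x) = Σ_ν x_ν·A_ν`
(labels `x_ν ∈ [0, N₀)`), `Ψ = φ + Λ` is constant along every non-wrapping constrained bond and jumps by `−N₀·A_μ` along the wrapping ones (§4, `val_embIter`); the potential-at-the-top argument
of `N12FlatHndConnLetter.T_shift_eq` run with a seam monodromy `w` (§2: the one constrained bond used in each case is adjacent to the fine bond, so it wraps exactly when the fine bond does, §1;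
in-block steps never wrap) transfers the law to the fine bonds, and once around the fine torus (§3) gives `w_μ = N₀·A_μ = 0` (§4), i.e. `A = 0` over `ℂ` (§5 ★★★ `harmonic_Bj`).

CONTENTS.  §1 `val_iterBlockOf_add_one_eq_of_wrap`, `iterBlockOf_shift_ne_of_wrap`, ★ `wrap_iff_of_iterBlockOf_shift`, `not_wrap_of_iterBlockOf_shift_eq`; §2 ★★ `T_shift_add_seam_eq`; §3 ★ `seam_eq_zero_of_shift_law`;
§4 `embIter_shift_apply_of_ne`, ★★★ `sitesPerDir_nsmul_eq_zero_of_constr_Bj`; §5 ★★★ `harmonic_Bj`, ★★ `exists_locConstGauge_of_plaq_eq_zero_of_iterLin_eq_zero_of_harmonic` (any determining set, (L♭) for (L)),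
★★★ `eq_zero_of_fderiv_msChart_one_eq_zero_of_hierAxial_of_harmonic` ((β)♭ on the `𝐁`-adapted hierarchical axial slice modulo (L♭), (Cov), (C) — matrix-level throughout), ★★★ `hnondeg_real_flat_hierAxial_Bj_allZ`
(the record's shape for `𝐁_k(Z)`, EVERY `Z`: hypotheses left `1 ≤ M₁`, `1 ≤ k ≤ m + K`, cover divisibility, the `Q`-recursion data, slice membership, the kernel letter `hker`, the bilinear hypothesis `hq`).

HONEST FRAMING.  Pure lattice geometry ∕ linear algebra at the FLAT configuration (`U₀ = 1`); REAL statements; the analytic letters (`hker`, `hq`), `honto` for the `𝐁`-adapted slice (upstream),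
the near-flat backgrounds `U₀ ≠ 1` and the complexification stay displayed ∕ with their owners; nothing of Bałaban's estimates is asserted; N12 NOT discharged; K1⁷ NOT closed; counts unmoved
(typed 28∕28 · discharged 5∕27); one finite 𝕋⁴ programme at fixed ε — R4 closes the conditional rung `BalabanLadder.UV` only; the Yang–Mills mass gap (Clay) is NOT proved by any of this;
nothing continuum ∕ ℝ⁴ ∕ OS.
-/

noncomputable section

namespace Summit.QuantumFields.YangMills.BalabanUVNodes.N12FlatHndHarmonicLetter

open Literature.MathematicalPhysics.QuantumFieldTheory.Balaban1983to89
open B15DeterminingSets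
open B5Eq118OneStroke (iterBlockOf val_iterBlockOf)
open B6QGQTestBumpsKLevelV1 (val_shift_self')
open Summit.QuantumFields.YangMills.Theorems.Prop7FlatHolonomy (sitesPerDir_zero_eq_mul_pow)

variable {P : Params}

/-! ## §1 Seam arithmetic: which unit steps wrap around the torus -/

/-- A fine site on the seam of direction `μ` (`z_μ = N₀ − 1`) lies in the LAST `a`-block of that direction: its block label is `N_a − 1`. [cite: Balaban1987RG1, (0.1) p.251] -/
theorem val_iterBlockOf_add_one_eq_of_wrap {a : ℕ} (ha : a ≤ P.m + P.K) (z : Site P 0) (μ : Fin P.d) (h : (z μ).val + 1 = P.sitesPerDir 0) :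
    ((iterBlockOf a z) μ).val + 1 = P.sitesPerDir a := by
  have hN0 : P.sitesPerDir 0 = P.sitesPerDir a * P.L ^ a := sitesPerDir_zero_eq_mul_pow ha
  have ht : 0 < P.L ^ a := pow_pos P.L_pos a
  rw [val_iterBlockOf a ha]
  set t := P.L ^ a
  have hdm := Nat.div_add_mod (z μ).val t
  have hr := Nat.mod_lt (z μ).val ht
  have h1 : t * ((z μ).val / t) < t * P.sitesPerDir a := by rw [Nat.mul_comm t (P.sitesPerDir a)]; omega
  have h2 : t * P.sitesPerDir a ≤ t * ((z μ).val / t + 1) := by rw [Nat.mul_add, Nat.mul_one, Nat.mul_comm t (P.sitesPerDir a)]; omega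
  have := Nat.lt_of_mul_lt_mul_left h1; have := Nat.le_of_mul_le_mul_left h2 ht; omega

/-- A unit step across the seam changes the `a`-block (there are at least two blocks per direction). [cite: Balaban1987RG1, (0.1) p.251] -/
theorem iterBlockOf_shift_ne_of_wrap {a : ℕ} (ha : a ≤ P.m + P.K) (z : Site P 0) (μ : Fin P.d) (h : (z μ).val + 1 = P.sitesPerDir 0) :
    iterBlockOf a (z.shift μ) ≠ iterBlockOf a z := by
  intro heq
  have h1 := val_iterBlockOf_add_one_eq_of_wrap ha z μ h
  have h2 := congrArg (fun y : Site P a => (y μ).val) heq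
  simp only [val_iterBlockOf a ha] at h2
  rw [val_shift_self', h, Nat.mod_self, Nat.zero_div] at h2
  rw [val_iterBlockOf a ha] at h1; have := P.one_lt_sitesPerDir a; omega

/-- For ADJACENT `a`-blocks `B(z + e_μ) = B(z) + e_μ`: the block step wraps around `T^{(a)}` iff the fine step wraps around `T^{(0)}`. [cite: Balaban1987RG1, (0.1) p.251] -/
theorem wrap_iff_of_iterBlockOf_shift {a : ℕ} (ha : a ≤ P.m + P.K) (z : Site P 0) (μ : Fin P.d)
    (hadj : iterBlockOf a (z.shift μ) = (iterBlockOf a z).shift μ) :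
    ((iterBlockOf a z) μ).val + 1 = P.sitesPerDir a ↔ (z μ).val + 1 = P.sitesPerDir 0 := by
  refine ⟨fun h => ?_, val_iterBlockOf_add_one_eq_of_wrap ha z μ⟩
  have ht : 0 < P.L ^ a := pow_pos P.L_pos a
  have hq : (((iterBlockOf a z).shift μ) μ).val = 0 := by rw [val_shift_self', h, Nat.mod_self]
  rw [← hadj, val_iterBlockOf a ha, val_shift_self', Nat.div_eq_zero_iff_lt ht] at hq
  by_contra hne  -- if the fine step did not wrap, `z_μ + 1 < L^a`, so the block label of `z` is `0`, contradicting `N_a ≥ 2`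
  have hlt : (z μ).val + 1 < P.sitesPerDir 0 := lt_of_le_of_ne (ZMod.val_lt (z μ)) hne
  rw [Nat.mod_eq_of_lt hlt] at hq
  have h0 : ((iterBlockOf a z) μ).val = 0 := by rw [val_iterBlockOf a ha]; exact Nat.div_eq_of_lt (by omega)
  have := P.one_lt_sitesPerDir a; omega

/-- A unit step INSIDE one `a`-block never wraps. [cite: Balaban1987RG1, (0.1) p.251] -/
theorem not_wrap_of_iterBlockOf_shift_eq {a : ℕ} (ha : a ≤ P.m + P.K) (z : Site P 0) (μ : Fin P.d) (h : iterBlockOf a (z.shift μ) = iterBlockOf a z) :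
    (z μ).val + 1 ≠ P.sitesPerDir 0 := fun hw => iterBlockOf_shift_ne_of_wrap ha z μ hw h

/-! ## §2 The potential read at the tops, with a seam monodromy -/

open scoped Classical

section Seam

open Literature.MathematicalPhysics.QuantumFieldTheory.Balaban1983to89.B14.Eq213DetSet (Bj maxDomT isBlockUnion_maxDomT)
open Literature.MathematicalPhysics.QuantumFieldTheory.Balaban1983to89.B14.Eq213MaximalDomains (side)
open Literature.MathematicalPhysics.QuantumFieldTheory.BalabanImbrieJaffe1984to88.BIJ88RT51Background (iterBlockOf_embIter)
open B6CubeRightLegsV1 (iterBlockOf_shift_or)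
open N12FlatHndConnLetter (blockConst_of_adjacent mem_iff_centre_mem iterBlockOf_mem_Bj_of_findGreatest_eq not_mem_maxDomT_of_findGreatest_lt
  embIter_mem_maxDomT_of_mem_Bj findGreatest_lt_of_block_disjoint T_eq_of_findGreatest_eq T_centre_of_block_disjoint)

variable {V : Type*} [AddCommGroup V] {M₁ : ℕ} {Z : Set (Site P 0)} {k : ℕ}
variable (hM : 1 ≤ M₁) (hk : 1 ≤ k) (hkK : k ≤ P.m + P.K) (hdiv : side P.L M₁ k ∣ P.sitesPerDir 0)
variable (ψ : Site P 0 → V) (T : Site P 0 → V)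
variable (hT : ∀ z, T z = ψ (embIter (Nat.findGreatest (fun i => z ∈ maxDomT M₁ Z i) k) (iterBlockOf (Nat.findGreatest (fun i => z ∈ maxDomT M₁ Z i) k) z)))
variable (w : Fin P.d → V)
include hM hk hkK hdiv hT

/-- ★★ **CONTINUITY OF THE TOP POTENTIAL UP TO A SEAM MONODROMY**: if `ψ` is constant along every constrained bond of `𝐁_k(Z)` that does not wrap around the torus and jumps by `−w_μ` along the
wrapping ones (block label `N_j − 1 → 0` in direction `μ`), then `T(z) = ψ(top of z)` has the same law on the FINE bonds: `T(z + e_μ) + [z_μ = N₀ − 1]·w_μ = T(z)`.  Same induction as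
`N12FlatHndConnLetter.T_shift_eq`; the one constrained bond used in each case is adjacent to the fine bond, so it wraps exactly when the fine bond does (`wrap_iff_of_iterBlockOf_shift`), and
in-block steps never wrap. [cite: Balaban1988Convergent, (2.2) p.255, (2.13) pp.256-257] -/
theorem T_shift_add_seam_eq
    (hψ : ∀ j, j ≤ k → ∀ c ∈ bondsOf ((Bj M₁ Z k : DetSet P) j),
      ψ (embIter j c.tgt) + (if (c.src c.dir).val + 1 = P.sitesPerDir j then w c.dir else 0) = ψ (embIter j c.src)) :
    ∀ (i : ℕ) (z : Site P 0) (μ : Fin P.d), Nat.findGreatest (fun i => z ∈ maxDomT M₁ Z i) k < i →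
      Nat.findGreatest (fun i => z.shift μ ∈ maxDomT M₁ Z i) k < i →
        T (z.shift μ) + (if (z μ).val + 1 = P.sitesPerDir 0 then w μ else 0) = T z := by
  intro i
  induction i using Nat.strong_induction_on with | _ i ih => ?_
  intro z μ hzi hz'i
  -- constancy of `T` on every `j`-block disjoint from `Ω_j`, `1 ≤ j < i`, `j ≤ k` (in-block steps do not wrap)
  have hblock : ∀ j, 1 ≤ j → j < i → j ≤ k → ∀ (Y : Site P j), embIter j Y ∉ maxDomT M₁ Z j →
      ∀ u u' : Site P 0, iterBlockOf j u = Y → iterBlockOf j u' = Y → T u = T u' := by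
    refine fun j hj1 hji hjk Y hY u u' hu hu' => blockConst_of_adjacent (hjk.trans hkK) Y T (fun x ν hx hxν => ?_) hu hu'
    have h := ih j hji x ν (findGreatest_lt_of_block_disjoint hM hkK hdiv hj1 hjk hY hx) (findGreatest_lt_of_block_disjoint hM hkK hdiv hj1 hjk hY hxν)
    rwa [if_neg (not_wrap_of_iterBlockOf_shift_eq (hjk.trans hkK) x ν (hxν.trans hx.symm)), add_zero] at h
  set a := Nat.findGreatest (fun i => z ∈ maxDomT M₁ Z i) k with ha
  set a' := Nat.findGreatest (fun i => z.shift μ ∈ maxDomT M₁ Z i) k with ha'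
  have hak : a ≤ k := Nat.findGreatest_le k
  have ha'k : a' ≤ k := Nat.findGreatest_le k
  have htop : iterBlockOf a z ∈ (Bj M₁ Z k : DetSet P) a := iterBlockOf_mem_Bj_of_findGreatest_eq hM hk hkK hdiv z ha.symm
  have htop' : iterBlockOf a' (z.shift μ) ∈ (Bj M₁ Z k : DetSet P) a' := iterBlockOf_mem_Bj_of_findGreatest_eq hM hk hkK hdiv (z.shift μ) ha'.symm
  rcases lt_trichotomy a a' with hlt | heq | hgt
  · -- `a < a'`: one constrained bond at level `a'` from the OUTER neighbour block `Y ∋ z` to the member block of `z + e_μ`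
    have ha'1 : 1 ≤ a' := by omega
    have hY : embIter a' (iterBlockOf a' z) ∉ maxDomT M₁ Z a' := fun h => not_mem_maxDomT_of_findGreatest_lt z ha.symm hlt ha'k
      ((mem_iff_centre_mem (isBlockUnion_maxDomT hM hdiv ha'1 ha'k (ha'k.trans hkK)) z).2 h)
    have hY'in : embIter a' (iterBlockOf a' (z.shift μ)) ∈ maxDomT M₁ Z a' := embIter_mem_maxDomT_of_mem_Bj ha'1 ha'k htop'
    have hadj : iterBlockOf a' (z.shift μ) = (iterBlockOf a' z).shift μ := (iterBlockOf_shift_or a' (ha'k.trans hkK) z μ).resolve_left fun h => absurd (h ▸ hY'in) hY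
    have hbond := hψ a' ha'k ⟨iterBlockOf a' z, μ⟩ (Or.inr (show (iterBlockOf a' z).shift μ ∈ _ by rw [← hadj]; exact htop'))
    rw [if_congr (wrap_iff_of_iterBlockOf_shift (ha'k.trans hkK) z μ hadj) rfl rfl] at hbond
    calc T (z.shift μ) + (if (z μ).val + 1 = P.sitesPerDir 0 then w μ else 0)
        = ψ (embIter a' (iterBlockOf a' (z.shift μ))) + (if (z μ).val + 1 = P.sitesPerDir 0 then w μ else 0) := by rw [T_eq_of_findGreatest_eq ψ T hT _ ha'.symm]
      _ = ψ (embIter a' (iterBlockOf a' z)) := by rw [hadj]; exact hbond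
      _ = T (embIter a' (iterBlockOf a' z)) := (T_centre_of_block_disjoint hM hkK hdiv ψ T hT ha'1 ha'k hY).symm
      _ = T z := hblock a' ha'1 hz'i ha'k (iterBlockOf a' z) hY _ _ (iterBlockOf_embIter a' (ha'k.trans hkK) _) rfl
  · -- `a = a'`: the two member blocks are equal (an in-block step: no seam) or adjacent (one constrained bond)
    have hT' : T (z.shift μ) = ψ (embIter a (iterBlockOf a (z.shift μ))) := T_eq_of_findGreatest_eq ψ T hT _ (ha'.symm.trans heq.symm)
    rw [hT', T_eq_of_findGreatest_eq ψ T hT z ha.symm]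
    rcases iterBlockOf_shift_or a (hak.trans hkK) z μ with h | h
    · rw [h, if_neg (not_wrap_of_iterBlockOf_shift_eq (hak.trans hkK) z μ h), add_zero]
    · have hbond := hψ a hak ⟨iterBlockOf a z, μ⟩ (Or.inl htop)
      rw [if_congr (wrap_iff_of_iterBlockOf_shift (hak.trans hkK) z μ h) rfl rfl] at hbond
      rw [h]; exact hbond
  · -- `a' < a`: symmetric to the first case
    have ha1 : 1 ≤ a := by omega
    have hY' : embIter a (iterBlockOf a (z.shift μ)) ∉ maxDomT M₁ Z a := fun h => not_mem_maxDomT_of_findGreatest_lt (z.shift μ) ha'.symm hgt hak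
      ((mem_iff_centre_mem (isBlockUnion_maxDomT hM hdiv ha1 hak (hak.trans hkK)) (z.shift μ)).2 h)
    have hYin : embIter a (iterBlockOf a z) ∈ maxDomT M₁ Z a := embIter_mem_maxDomT_of_mem_Bj ha1 hak htop
    have hadj : iterBlockOf a (z.shift μ) = (iterBlockOf a z).shift μ := (iterBlockOf_shift_or a (hak.trans hkK) z μ).resolve_left fun h => absurd (h ▸ hYin) hY'
    have hbond := hψ a hak ⟨iterBlockOf a z, μ⟩ (Or.inl htop)
    rw [if_congr (wrap_iff_of_iterBlockOf_shift (hak.trans hkK) z μ hadj) rfl rfl] at hbond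
    calc T (z.shift μ) + (if (z μ).val + 1 = P.sitesPerDir 0 then w μ else 0)
        = ψ (embIter a (iterBlockOf a (z.shift μ))) + (if (z μ).val + 1 = P.sitesPerDir 0 then w μ else 0) := by
          rw [hblock a ha1 hzi hak (iterBlockOf a (z.shift μ)) hY' _ _ rfl (iterBlockOf_embIter a (hak.trans hkK) _), T_centre_of_block_disjoint hM hkK hdiv ψ T hT ha1 hak hY']
      _ = ψ (embIter a (iterBlockOf a z)) := by rw [hadj]; exact hbond
      _ = T z := (T_eq_of_findGreatest_eq ψ T hT z ha.symm).symm

end Seam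

/-! ## §3 A fine-bond law with a seam term forces the seam term to vanish (once around the torus) -/

section Loop

variable {V : Type*} [AddCommGroup V]

/-- **ONCE AROUND THE TORUS**: if `T(z + e_μ) + [z_μ = N₀ − 1]·w_μ = T(z)` for every fine site `z`, then `w_μ = 0` — telescope `T` along the `μ`-line through the origin, which crosses the seam
exactly once. [folklore] -/
theorem seam_eq_zero_of_shift_law (T : Site P 0 → V) (w : Fin P.d → V)
    (h : ∀ (z : Site P 0) (μ : Fin P.d), T (z.shift μ) + (if (z μ).val + 1 = P.sitesPerDir 0 then w μ else 0) = T z) (μ : Fin P.d) :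
    w μ = 0 := by
  set N := P.sitesPerDir 0 with hNdef
  set zi : ℕ → Site P 0 := fun i => (fun x : Site P 0 => x.shift μ)^[i] (fun _ => 0) with hzi
  have hsucc : ∀ i, zi (i + 1) = (zi i).shift μ := fun i => Function.iterate_succ_apply' _ _ _
  have hμ : ∀ i, (zi i) μ = (i : ZMod N) := fun i => by
    induction i with
    | zero => simp [hzi]
    | succ i ih => rw [hsucc]; simp only [Site.shift, Function.update_self]; rw [ih, Nat.cast_succ]
  have hν : ∀ i (ν : Fin P.d), ν ≠ μ → (zi i) ν = 0 := fun i ν hne => by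
    induction i with
    | zero => simp [hzi]
    | succ i ih => rw [hsucc]; simp only [Site.shift, Function.update_of_ne hne]; exact ih
  have hN : zi N = zi 0 := funext fun ν => by
    by_cases hn : ν = μ
    · subst hn; rw [hμ, hμ, ZMod.natCast_self, Nat.cast_zero]
    · rw [hν _ _ hn, hν _ _ hn]
  have hval : ∀ i, i < N → ((zi i) μ).val = i := fun i hi => by rw [hμ, ZMod.val_natCast, Nat.mod_eq_of_lt hi]
  have hstep : ∀ i ∈ Finset.range N, T (zi (i + 1)) + (if i + 1 = N then w μ else 0) = T (zi i) := fun i hi => by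
    have := h (zi i) μ; rwa [← hsucc, hval i (Finset.mem_range.1 hi)] at this
  have hsum := Finset.sum_congr rfl hstep
  have htel : ∑ i ∈ Finset.range N, T (zi (i + 1)) = ∑ i ∈ Finset.range N, T (zi i) := by
    have h2 := Finset.sum_range_succ (fun i => T (zi i)) N
    rw [hN] at h2
    exact add_right_cancel ((Finset.sum_range_succ' (fun i => T (zi i)) N).symm.trans h2)
  rw [Finset.sum_add_distrib, htel, add_comm] at hsum
  have hN1 : 2 ≤ N := P.one_lt_sitesPerDir 0
  have hite : ∑ i ∈ Finset.range N, (if i + 1 = N then w μ else 0) = w μ := by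
    rw [Finset.sum_eq_single (N - 1) (fun b _ hne => if_neg (by omega)) (fun hb => absurd (Finset.mem_range.2 (by omega)) hb), if_pos (by omega)]
  exact hite ▸ add_eq_right.1 hsum

end Loop

/-! ## §4 ★★★ The harmonic letter for `𝐁_k(Z)`: a constrained affine potential has no constant part (times `N₀`) -/

section Harmonic

open Literature.MathematicalPhysics.QuantumFieldTheory.Balaban1983to89.B14.Eq213DetSet (Bj maxDomT)
open Literature.MathematicalPhysics.QuantumFieldTheory.Balaban1983to89.B14.Eq213MaximalDomains (side)
open Summit.QuantumFields.YangMills.Theorems.Prop7TentInterpolation (val_embIter)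

variable {V : Type*} [AddCommGroup V] {M₁ : ℕ} {Z : Set (Site P 0)} {k : ℕ}

/-- Labels of a centre off the direction of a coarse step do not move. [cite: Balaban1987RG1, (0.1) p.251] -/
theorem embIter_shift_apply_of_ne {j : ℕ} (hj : j ≤ P.m + P.K) (y : Site P j) {μ ν : Fin P.d} (h : ν ≠ μ) :
    embIter j (y.shift μ) ν = embIter j y ν := by
  apply ZMod.val_injective
  rw [val_embIter hj, val_embIter hj]; simp [Site.shift, Function.update_of_ne h]

/-- ★★★ **THE HARMONIC LETTER FOR THE RECORD's `𝐁_k(Z)`** (what the loop letter (L) was for, now for EVERY `Z`): if a fine site function `φ` and a constant vector function `A` satisfy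
`φ(c₊) − φ(c₋) + L^j·A(dir c) = 0` (read at the `j`-fold centres) on every constrained bond of `𝐁_k(Z)`, then `N₀·A_μ = 0` for every `μ`: `Ψ = φ + Σ_ν x_ν·A_ν` (labels `x_ν ∈ [0, N₀)`) is
constant along the non-wrapping constrained bonds and jumps by `−N₀·A_μ` along the wrapping ones (`val_embIter`), so `T_shift_add_seam_eq` + `seam_eq_zero_of_shift_law` apply.  Hypotheses:
`1 ≤ M₁`, `1 ≤ k ≤ m + K`, cover divisibility. [cite: Balaban1988Convergent, (2.2) p.255, (2.13) pp.256-257] -/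
theorem sitesPerDir_nsmul_eq_zero_of_constr_Bj (hM : 1 ≤ M₁) (hk : 1 ≤ k) (hkK : k ≤ P.m + P.K) (hdiv : side P.L M₁ k ∣ P.sitesPerDir 0)
    (φ : Site P 0 → V) (A : Fin P.d → V)
    (hφ : ∀ j, j ≤ k → ∀ c ∈ bondsOf ((Bj M₁ Z k : DetSet P) j), φ (embIter j c.tgt) - φ (embIter j c.src) + (P.L ^ j) • A c.dir = 0) (μ : Fin P.d) :
    P.sitesPerDir 0 • A μ = 0 := by
  set Λ : Site P 0 → V := fun x => ∑ ν, (x ν).val • A ν with hΛ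
  obtain ⟨T, hT⟩ : ∃ T : Site P 0 → V, ∀ z, T z = (fun x => φ x + Λ x) (embIter (Nat.findGreatest (fun i => z ∈ maxDomT M₁ Z i) k)
      (iterBlockOf (Nat.findGreatest (fun i => z ∈ maxDomT M₁ Z i) k) z)) := ⟨_, fun _ => rfl⟩
  refine seam_eq_zero_of_shift_law T (fun ν => P.sitesPerDir 0 • A ν) (fun z ν =>
    T_shift_add_seam_eq hM hk hkK hdiv (fun x => φ x + Λ x) T hT (fun ν => P.sitesPerDir 0 • A ν) ?_ (k + 1) z ν
      (Nat.lt_succ_of_le (Nat.findGreatest_le k)) (Nat.lt_succ_of_le (Nat.findGreatest_le k))) μ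
  -- `Ψ` along a constrained bond `c = (y, μ')` of level `j`
  rintro j hj ⟨y, μ'⟩ hc
  have hjK : j ≤ P.m + P.K := hj.trans hkK
  have key := hφ j hj ⟨y, μ'⟩ hc
  have hN0 : P.sitesPerDir 0 = P.sitesPerDir j * P.L ^ j := sitesPerDir_zero_eq_mul_pow hjK
  -- the label potential moves only in the `μ'`-slot
  have hΛdiff : ∀ x x' : Site P 0, (∀ ν, ν ≠ μ' → x' ν = x ν) → Λ x' + (x μ').val • A μ' = Λ x + (x' μ').val • A μ' := by
    intro x x' hxx'
    simp only [hΛ]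
    rw [← Finset.sum_erase_add _ _ (Finset.mem_univ μ'), ← Finset.sum_erase_add _ _ (Finset.mem_univ μ'),
      Finset.sum_congr rfl fun ν hν => by rw [hxx' ν (Finset.ne_of_mem_erase hν)]]
    abel
  have hΛc := hΛdiff (embIter j y) (embIter j (y.shift μ')) fun ν hν => embIter_shift_apply_of_ne hjK y hν
  rw [val_embIter hjK, val_embIter hjK, val_shift_self'] at hΛc
  show φ (embIter j (y.shift μ')) + Λ (embIter j (y.shift μ')) + (if (y μ').val + 1 = P.sitesPerDir j then P.sitesPerDir 0 • A μ' else 0) =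
    φ (embIter j y) + Λ (embIter j y)
  change φ (embIter j (y.shift μ')) - φ (embIter j y) + P.L ^ j • A μ' = 0 at key
  have hφ' : φ (embIter j (y.shift μ')) = φ (embIter j y) - P.L ^ j • A μ' := by rw [← sub_eq_zero, ← key]; abel
  by_cases hw : (y μ').val + 1 = P.sitesPerDir j
  · -- wrapping bond: the label drops from `(N_j − 1)·L^j + c` to `c`
    have hmod : ((y μ').val + 1) % P.sitesPerDir j = 0 := by rw [hw, Nat.mod_self]
    rw [hmod, zero_mul, zero_add, add_smul] at hΛc
    have hΛc' : Λ (embIter j (y.shift μ')) = Λ (embIter j y) - ((y μ').val * P.L ^ j) • A μ' :=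
      calc Λ (embIter j (y.shift μ'))
          = Λ (embIter j (y.shift μ')) + (((y μ').val * P.L ^ j) • A μ' + ((P.L ^ j - 1) / 2) • A μ') - (((y μ').val * P.L ^ j) • A μ' + ((P.L ^ j - 1) / 2) • A μ') := by abel
        _ = Λ (embIter j y) - ((y μ').val * P.L ^ j) • A μ' := by rw [hΛc]; abel
    have hN0' : P.sitesPerDir 0 = (y μ').val * P.L ^ j + P.L ^ j :=
      calc P.sitesPerDir 0 = P.sitesPerDir j * P.L ^ j := hN0
        _ = ((y μ').val + 1) * P.L ^ j := by rw [hw]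
        _ = (y μ').val * P.L ^ j + P.L ^ j := add_one_mul _ _
    rw [if_pos hw, hN0', add_smul, hΛc', hφ']
    abel
  · -- non-wrapping bond: the label grows by `L^j`
    have hlt : (y μ').val + 1 < P.sitesPerDir j := lt_of_le_of_ne (ZMod.val_lt _) hw
    rw [Nat.mod_eq_of_lt hlt, Nat.add_mul, one_mul] at hΛc
    have hΛc' : Λ (embIter j (y.shift μ')) = Λ (embIter j y) + P.L ^ j • A μ' :=
      calc Λ (embIter j (y.shift μ'))
          = Λ (embIter j (y.shift μ')) + ((y μ').val * P.L ^ j + (P.L ^ j - 1) / 2) • A μ' - ((y μ').val * P.L ^ j + (P.L ^ j - 1) / 2) • A μ' := by abel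
        _ = Λ (embIter j y) + P.L ^ j • A μ' := by rw [hΛc, add_smul, add_smul, add_smul]; abel
    rw [if_neg hw, add_zero, hΛc', hφ']
    abel

end Harmonic

/-! ## §5 The harmonic letter (L♭) in place of the loop letter (L): the flat null space and (β)♭ on the `𝐁`-adapted slice, then `𝐁_k(Z)` for EVERY `Z` -/

section Chain

open scoped BigOperators Matrix.Norms.L2Operator Topology
open T4Continuum (T4Family)
open BlockAveragingEMLLinearised (linAvg)
open T4AdjointCovarianceUnitary (lieSU)
open B10Eq27TorusAxialLog (axialT)
open Node00
open Literature.MathematicalPhysics.QuantumFieldTheory.Balaban1983to89.B14.Eq213DetSet (Bj)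
open Literature.MathematicalPhysics.QuantumFieldTheory.Balaban1983to89.B14.Eq213MaximalDomains (side)
open Summit.QuantumFields.YangMills.Theorems.Prop7CombGauge (iterLin_add)
open Summit.QuantumFields.YangMills.Theorems.Prop7AvgLinearisation (iterLin_grad)
open N12FlatFibreNullSpace (iterLin_dirConst exists_grad_add_dirConst_of_plaq_eq_zero_matrix)
open N12FlatFibreNullSpaceDetSet (iterLin_eq_zero_of_fderiv_msChart_one_eq_zero_detSet)
open N12FlatChartHnd (coe_plaq_eq_zero_of_deriv_deriv_eq_zero)
open N12FlatHierAxialHndDetSet (grad_eq_zero_of_hierAxial_of_locConst)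

variable {n : Type*} {M₁ : ℕ} {Z : Set (Site P 0)} {k : ℕ}

/-- ★★★ **THE HARMONIC LETTER (L♭) HOLDS FOR `𝐁_k(Z)`, EVERY `Z`** (matrix-valued reading of `sitesPerDir_nsmul_eq_zero_of_constr_Bj`: `N₀ ≠ 0` in `ℂ`): a constrained affine potential on `𝐁_k(Z)` has
zero constant part. Hypotheses: `1 ≤ M₁`, `1 ≤ k ≤ m + K`, cover divisibility. [cite: Balaban1988Convergent, (2.2) p.255, (2.13) pp.256-257] -/
theorem harmonic_Bj (hM : 1 ≤ M₁) (hk : 1 ≤ k) (hkK : k ≤ P.m + P.K) (hdiv : side P.L M₁ k ∣ P.sitesPerDir 0)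
    (φ₀ : Site P 0 → Matrix n n ℂ) (A : Fin P.d → Matrix n n ℂ)
    (hφ : ∀ j, j ≤ k → ∀ c ∈ bondsOf ((Bj M₁ Z k : DetSet P) j), φ₀ (embIter j c.tgt) - φ₀ (embIter j c.src) + (P.L ^ j : ℕ) • A c.dir = 0) (μ : Fin P.d) :
    A μ = 0 := by
  have h := sitesPerDir_nsmul_eq_zero_of_constr_Bj hM hk hkK hdiv φ₀ A hφ μ
  rw [← Nat.cast_smul_eq_nsmul ℂ, smul_eq_zero] at h
  exact h.resolve_left (Nat.cast_ne_zero.mpr (P.sitesPerDir_ne_zero 0))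

/-- ★★ **THE LOCALLY-CONSTANT GAUGE UNDER THE HARMONIC LETTER** (`N12FlatFibreNullSpaceDetSet.exists_locConstGauge_of_plaq_eq_zero_of_iterLin_eq_zero_detSet` with (L) replaced by (L♭) `hharm`: every
constrained affine potential has zero constant part): curl-free `X` with vanishing constrained averages is `dφ` with `φ` constant along every constrained bond at the `j`-fold centres.
[cite: Balaban1988Convergent, (2.2) p.255; Balaban1985Variational, Sect. E p.300] -/
theorem exists_locConstGauge_of_plaq_eq_zero_of_iterLin_eq_zero_of_harmonic
    (Q : (i : ℕ) → (PBond P 0 → Matrix n n ℂ) → PBond P i → Matrix n n ℂ)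
    (hQ0 : ∀ Y, Q 0 Y = Y) (hQs : ∀ (i : ℕ) (Y : PBond P 0 → Matrix n n ℂ) (c : PBond P (i + 1)), Q (i + 1) Y c = linAvg (Q i Y) c)
    (𝔹 : DetSet P) (k : ℕ)
    (hharm : ∀ (φ₀ : Site P 0 → Matrix n n ℂ) (A : Fin P.d → Matrix n n ℂ),
      (∀ j, j ≤ k → ∀ c ∈ bondsOf (𝔹 j), φ₀ (embIter j c.tgt) - φ₀ (embIter j c.src) + (P.L ^ j : ℕ) • A c.dir = 0) → ∀ μ, A μ = 0)
    (X : PBond P 0 → Matrix n n ℂ)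
    (hcurl : ∀ p : Plaq P 0, X ⟨p.src, p.μ⟩ + X ⟨p.src.shift p.μ, p.ν⟩ - X ⟨p.src.shift p.ν, p.μ⟩ - X ⟨p.src, p.ν⟩ = 0)
    (hQ : ∀ j, j ≤ k → ∀ c ∈ bondsOf (𝔹 j), Q j X c = 0) :
    ∃ φ : Site P 0 → Matrix n n ℂ, (∀ j, j ≤ k → ∀ c ∈ bondsOf (𝔹 j), φ (embIter j c.tgt) = φ (embIter j c.src)) ∧
      ∀ b : PBond P 0, X b = φ b.tgt - φ b.src := by
  obtain ⟨φ₀, A, hX⟩ := exists_grad_add_dirConst_of_plaq_eq_zero_matrix X hcurl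
  have hXf : X = fun b : PBond P 0 => (φ₀ b.tgt - φ₀ b.src) + A b.dir := funext hX
  -- `Q^{(j)}X = d(φ₀∘embIter j) + L^j·A₀ = 0` on the constrained bonds, so `A = 0` by (L♭)
  have hk : ∀ j, j ≤ k → ∀ c ∈ bondsOf (𝔹 j), φ₀ (embIter j c.tgt) - φ₀ (embIter j c.src) + (P.L ^ j : ℕ) • A c.dir = 0 := by
    intro j hj c hc
    have h := hQ j hj c hc
    rwa [hXf, iterLin_add Q hQ0 hQs (fun b : PBond P 0 => φ₀ b.tgt - φ₀ b.src) (fun b => A b.dir) j c,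
      iterLin_grad Q hQ0 hQs (fun i φ y => φ (embIter i y)) (fun φ => rfl) (fun i φ y => rfl) φ₀ j c, iterLin_dirConst Q hQ0 hQs A j c] at h
  have hA : ∀ μ : Fin P.d, A μ = 0 := hharm φ₀ A hk
  refine ⟨φ₀, fun j hj c hc => ?_, fun b => by rw [hX b, hA, add_zero]⟩
  have h := hk j hj c hc
  rwa [hA, smul_zero, add_zero, sub_eq_zero] at h

variable {F : T4Family} {N : ℕ} [NeZero N] {K : ℕ}

/-- ★★★ **(β)♭ AT NODE 00's FLAT CHART ON THE `𝐁`-ADAPTED HIERARCHICAL AXIAL SLICE, MODULO (L♭), (Cov), (C)** (`N12FlatHierAxialHndDetSet.eq_zero_of_fderiv_msChart_one_eq_zero_of_hierAxial_detSet` with the loop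
letter replaced by the harmonic letter): `X` hierarchically axial, `DΦ(0)X = 0`, `d²∕ds² A(e^{sX})|₀ = 0` ⟹ `X = 0`.  Matrix-level throughout: the potential of `exists_locConstGauge_…_of_harmonic` is
fed to `grad_eq_zero_of_hierAxial_of_locConst`. [cite: Balaban1989LargeFieldII, (1.9) p.358, p.359; Balaban1985RegularSpaces, (1.19) p.79; Balaban1988Convergent, (2.2) p.255, (2.13) pp.256-257] -/
theorem eq_zero_of_fderiv_msChart_one_eq_zero_of_hierAxial_of_harmonic {k : ℕ} (hk : k ≤ (F.P K).m + (F.P K).K)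
    (Q : (i : ℕ) → (PBond (F.P K) 0 → Matrix (Fin N) (Fin N) ℂ) → PBond (F.P K) i → Matrix (Fin N) (Fin N) ℂ)
    (hQ0 : ∀ Y, Q 0 Y = Y) (hQs : ∀ (i : ℕ) (Y : PBond (F.P K) 0 → Matrix (Fin N) (Fin N) ℂ) (c : PBond (F.P K) (i + 1)), Q (i + 1) Y c = linAvg (Q i Y) c)
    (𝔹 : DetSet (F.P K))
    (hharm : ∀ (φ₀ : Site (F.P K) 0 → Matrix (Fin N) (Fin N) ℂ) (A : Fin (F.P K).d → Matrix (Fin N) (Fin N) ℂ),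
      (∀ j, j ≤ k → ∀ c ∈ bondsOf (𝔹 j), φ₀ (embIter j c.tgt) - φ₀ (embIter j c.src) + ((F.P K).L ^ j : ℕ) • A c.dir = 0) → ∀ μ, A μ = 0)
    (hcov : ∀ z : Site (F.P K) 0, ∃ j, j ≤ k ∧ iterBlockOf j z ∈ 𝔹 j)
    (hconn : ∀ ψ : Site (F.P K) 0 → Matrix (Fin N) (Fin N) ℂ, (∀ j, j ≤ k → ∀ c ∈ bondsOf (𝔹 j), ψ (embIter j c.tgt) = ψ (embIter j c.src)) →
      ∀ j j', j ≤ k → j' ≤ k → ∀ c ∈ bondsOf (𝔹 j), ∀ c' ∈ bondsOf (𝔹 j'), ψ (embIter j c.src) = ψ (embIter j' c'.src))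
    {X : PBond (F.P K) 0 → lieSU (Fin N)}
    (hax : ∀ j, j ≤ k → ∀ y ∈ 𝔹 j, ∀ m, m < j → ∀ x : Site (F.P K) m, iterBlockOf j (embIter m x) = y →
      axialT (fun b : PBond (F.P K) m => Multiplicative.ofAdd (Q m (fun e => (X e : Matrix (Fin N) (Fin N) ℂ)) b)) (emb (blockOf x)) x = 1)
    (hker : fderiv ℝ (msChart F N K k 𝔹 (avgFamily (avOfRecord F N K) (1 : GaugeField (F.P K) 0 (SU N))) (1 : GaugeField (F.P K) 0 (SU N))) 0 X = 0)
    (hflat : deriv (deriv fun s : ℝ => wilsonAction4 (expChart (1 : GaugeField (F.P K) 0 (SU N)) (s • X))) 0 = 0) :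
    X = 0 := by
  have hQ : ∀ j, j ≤ k → ∀ c ∈ bondsOf (𝔹 j), Q j (fun b => (X b : Matrix (Fin N) (Fin N) ℂ)) c = 0 := fun j hj c hc =>
    iterLin_eq_zero_of_fderiv_msChart_one_eq_zero_detSet Q hQ0 hQs 𝔹 hker hj hc
  obtain ⟨φ₀, hφ₀, hXφ₀⟩ := exists_locConstGauge_of_plaq_eq_zero_of_iterLin_eq_zero_of_harmonic Q hQ0 hQs 𝔹 k hharm
    (fun b => (X b : Matrix (Fin N) (Fin N) ℂ)) (coe_plaq_eq_zero_of_deriv_deriv_eq_zero X hflat) hQ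
  have hXf : (fun b : PBond (F.P K) 0 => (X b : Matrix (Fin N) (Fin N) ℂ)) = fun e => φ₀ e.tgt - φ₀ e.src := funext hXφ₀
  have hgrad := grad_eq_zero_of_hierAxial_of_locConst Q hQ0 hQs hk 𝔹 hcov hconn φ₀ hφ₀ (fun j hj y hy m hm x hx => by
    rw [← hXf]; exact hax j hj y hy m hm x hx)
  funext b
  exact Subtype.ext (by rw [hXφ₀ b, hgrad b]; rfl)

/-- ★★★ **THE FLAT REAL `hnondeg` LETTER ON THE `𝐁_k(Z)`-ADAPTED HIERARCHICAL AXIAL SLICE FOR EVERY `Z` — ALL GEOMETRIC LETTERS DISCHARGED, NO LINE-MISS HYPOTHESIS**: the shape of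
`N12FlatHndConnLetter.hnondeg_real_flat_hierAxial_Bj` without `hline`, (L) being replaced by (L♭) `harmonic_Bj`.  Hypotheses left: `1 ≤ M₁`, `1 ≤ k ≤ m + K`, cover divisibility
`L^k·M₁ ∣ sitesPerDir 0`, the `Q`-recursion data, the slice membership `hs`, the kernel letter `hker`, the bilinear flat-Hessian hypothesis `hq`.
[cite: Balaban1989LargeFieldII, (1.9) p.358, p.359; Balaban1988Convergent, (2.2) p.255, (2.13) pp.256-257] -/
theorem hnondeg_real_flat_hierAxial_Bj_allZ {k : ℕ} (hk : k ≤ (F.P K).m + (F.P K).K) (hk1 : 1 ≤ k) {M₁ : ℕ} (hM : 1 ≤ M₁) {Z : Set (Site (F.P K) 0)}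
    (hdiv : side (F.P K).L M₁ k ∣ (F.P K).sitesPerDir 0)
    (Q : (i : ℕ) → (PBond (F.P K) 0 → Matrix (Fin N) (Fin N) ℂ) → PBond (F.P K) i → Matrix (Fin N) (Fin N) ℂ)
    (hQ0 : ∀ Y, Q 0 Y = Y) (hQs : ∀ (i : ℕ) (Y : PBond (F.P K) 0 → Matrix (Fin N) (Fin N) ℂ) (c : PBond (F.P K) (i + 1)), Q (i + 1) Y c = linAvg (Q i Y) c)
    (s : PBond (F.P K) 0 → lieSU (Fin N))
    (hs : ∀ j, j ≤ k → ∀ y ∈ (Bj M₁ Z k : DetSet (F.P K)) j, ∀ m, m < j → ∀ x : Site (F.P K) m, iterBlockOf j (embIter m x) = y →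
      axialT (fun b : PBond (F.P K) m => Multiplicative.ofAdd (Q m (fun e => (s e : Matrix (Fin N) (Fin N) ℂ)) b)) (emb (blockOf x)) x = 1)
    (hker : fderiv ℝ (msChart F N K k (Bj M₁ Z k) (avgFamily (avOfRecord F N K) (1 : GaugeField (F.P K) 0 (SU N))) (1 : GaugeField (F.P K) 0 (SU N))) 0 s = 0)
    (hq : ∀ t : PBond (F.P K) 0 → lieSU (Fin N),
      (∀ j, j ≤ k → ∀ y ∈ (Bj M₁ Z k : DetSet (F.P K)) j, ∀ m, m < j → ∀ x : Site (F.P K) m, iterBlockOf j (embIter m x) = y →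
        axialT (fun b : PBond (F.P K) m => Multiplicative.ofAdd (Q m (fun e => (t e : Matrix (Fin N) (Fin N) ℂ)) b)) (emb (blockOf x)) x = 1) →
      fderiv ℝ (msChart F N K k (Bj M₁ Z k) (avgFamily (avOfRecord F N K) (1 : GaugeField (F.P K) 0 (SU N))) (1 : GaugeField (F.P K) 0 (SU N))) 0 t = 0 →
      fderiv ℝ (fun Y => fderiv ℝ (fun Y : PBond (F.P K) 0 → lieSU (Fin N) => wilsonAction4 (expChart (1 : GaugeField (F.P K) 0 (SU N)) Y)) Y) 0 s t = 0) :
    s = 0 :=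
  eq_zero_of_fderiv_msChart_one_eq_zero_of_hierAxial_of_harmonic hk Q hQ0 hQs (Bj M₁ Z k) (harmonic_Bj hM hk1 hk hdiv)
    (N12FlatHndRecordLetters.hcov_Bj hM hk1 hk hdiv) (N12FlatHndConnLetter.hconn_Bj hM hk1 hk hdiv) hs hker
    (N12FlatHndRecordLetters.deriv_deriv_eq_zero_of_fderiv_fderiv_diag_eq_zero s (hq s hs hker))

end Chain

end Summit.QuantumFields.YangMills.BalabanUVNodes.N12FlatHndHarmonicLetter

end
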